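import Mathlib.Probability.BrownianMotion.Basic
import Mathlib.Probability.Process.FiniteDimensionalLaws
import HarnessLib

/-!
# Real Gaussian processes with the same mean and covariance functions have the same law

A real-valued Gaussian process is determined in law by its mean function `t ↦ E[X_t]` and its
covariance function `(s, t) ↦ Cov(X_s, X_t)`: the finite-dimensional distributions are Gaussian
vectors, which are determined by their mean vector and covariance matrix (characteristic
functions), and the law of a process on the product σ-algebra is determined by its
finite-dimensional distributions (Kolmogorov). Revuz–Yor, *Continuous Martingales and Brownian
Motion* (1999), Ch. I, §1, Prop. (1.?) / Kallenberg, *Foundations of Modern Probability* (2002),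
Lemma 13.1 ("the distribution of a Gaussian process is determined by its mean and covariance
functions").

* `IsGaussianProcess.map_restrict_eq_of_covariance_eq` — equal means and covariances give equal
  finite-dimensional distributions (Mathlib's `IsGaussian.ext` on `EuclideanSpace ℝ I`, exactly
  as in Mathlib's `IsGaussianProcess.isPreBrownianReal_of_covariance`);
* `IsGaussianProcess.map_eq_of_covariance_eq` — hence equal laws on `T → ℝ`
  (Mathlib's `map_eq_iff_forall_finset_map_restrict_eq`).

## References

* O. Kallenberg, *Foundations of Modern Probability* (2nd ed., 2002), Lemma 13.1.
* D. Revuz, M. Yor, *Continuous Martingales and Brownian Motion* (3rd ed., 1999), Ch. I §1.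
-/

noncomputable section

open MeasureTheory ProbabilityTheory WithLp
open scoped ENNReal NNReal

namespace Literature.Probability.Process

variable {T Ω : Type*} {mΩ : MeasurableSpace Ω} {P : Measure Ω} {X Y : T → Ω → ℝ}

/-- **Gaussian vectors with the same means and covariances have the same law**: for two real
Gaussian processes with equal mean and covariance functions, the finite-dimensional
distributions coincide (Kallenberg (2002), Lemma 13.1). The proof is Mathlib's proof of
`IsGaussianProcess.isPreBrownianReal_of_covariance` with the Brownian family replaced by the
second process: transport to `EuclideanSpace ℝ I` and apply `IsGaussian.ext`. Deliberate
dot-notation extension declared in Mathlib's namespace `ProbabilityTheory.IsGaussianProcess`.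
[cite: Kallenberg2002, Lemma 13.1] -/
theorem _root_.ProbabilityTheory.IsGaussianProcess.map_restrict_eq_of_covariance_eq
    (hX : IsGaussianProcess X P)
    (hY : IsGaussianProcess Y P) (hm : ∀ t, P[X t] = P[Y t])
    (hc : ∀ s t, cov[X s, X t; P] = cov[Y s, Y t; P]) (I : Finset T) :
    P.map (fun ω ↦ I.restrict (X · ω)) = P.map (fun ω ↦ I.restrict (Y · ω)) := by
  have hXa : AEMeasurable (fun ω ↦ I.restrict (X · ω)) P :=
    aemeasurable_pi_lambda _ fun _ ↦ hX.aemeasurable _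
  have hYa : AEMeasurable (fun ω ↦ I.restrict (Y · ω)) P :=
    aemeasurable_pi_lambda _ fun _ ↦ hY.aemeasurable _
  apply (MeasurableEquiv.toLp 2 (_ → ℝ)).map_measurableEquiv_injective
  rw [MeasurableEquiv.coe_toLp, ← PiLp.coe_symm_continuousLinearEquiv 2 ℝ]
  have := (hX.hasGaussianLaw I).isGaussian_map
  have := (hY.hasGaussianLaw I).isGaussian_map
  apply IsGaussian.ext
  · rw [integral_map, integral_map, integral_map, integral_map]
    · simp only [id_eq]
      rw [ContinuousLinearEquiv.integral_comp_comm, ContinuousLinearEquiv.integral_comp_comm]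
      congr 1
      ext i
      rw [eval_integral, eval_integral]
      · exact hm i
      · exact fun _ ↦ (hY.hasGaussianLaw_eval _).integrable
      · exact fun _ ↦ (hX.hasGaussianLaw_eval _).integrable
    all_goals fun_prop
  · rw [← ContinuousLinearMap.toBilinForm_inj]
    refine LinearMap.BilinForm.ext_of_isSymm isPosSemidef_covarianceBilin.isSymm
      isPosSemidef_covarianceBilin.isSymm fun x ↦ ?_
    simp only [ContinuousLinearMap.toBilinForm_apply]
    rw [PiLp.coe_symm_continuousLinearEquiv, covarianceBilin_apply_pi, covarianceBilin_apply_pi]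
    · congrm ∑ i, ∑ j, _ * ?_
      rw [covariance_map, covariance_map]
      · exact hc i j
      any_goals exact Measurable.aestronglyMeasurable (by fun_prop)
      · exact hYa
      · exact hXa
    · exact fun i ↦ ((hY.hasGaussianLaw I).isGaussian_map.hasGaussianLaw_id.eval i).memLp_two
    · exact fun i ↦ ((hX.hasGaussianLaw I).isGaussian_map.hasGaussianLaw_id.eval i).memLp_two

/-- **A real Gaussian process is determined in law by its mean and covariance functions**
(Kallenberg (2002), Lemma 13.1): two real Gaussian processes on the same probability space with
equal mean functions and equal covariance functions have the same law on `T → ℝ` (product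
σ-algebra). Deliberate dot-notation extension declared in Mathlib's namespace
`ProbabilityTheory.IsGaussianProcess`. [cite: Kallenberg2002, Lemma 13.1] -/
theorem _root_.ProbabilityTheory.IsGaussianProcess.map_eq_of_covariance_eq
    (hX : IsGaussianProcess X P)
    (hY : IsGaussianProcess Y P) (hm : ∀ t, P[X t] = P[Y t])
    (hc : ∀ s t, cov[X s, X t; P] = cov[Y s, Y t; P])
    (hXm : AEMeasurable (fun ω ↦ (X · ω)) P) (hYm : AEMeasurable (fun ω ↦ (Y · ω)) P) :
    P.map (fun ω ↦ (X · ω)) = P.map (fun ω ↦ (Y · ω)) := by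
  have := hX.isProbabilityMeasure
  exact (map_eq_iff_forall_finset_map_restrict_eq hXm hYm).2
    (hX.map_restrict_eq_of_covariance_eq hY hm hc)

end Literature.Probability.Process

end
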